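import Summits.BirchSwinnertonDyer.BirchSwinnertonDyer.Theorems.ClassRecordThreeCornerAtThreeShimuraOrderBoundDivOfImage
import Summits.BirchSwinnertonDyer.BirchSwinnertonDyer.Theorems.ClassRecordThreeCornerAtThreeShimuraPortTargetsOfImageTD
import HarnessLib

/-!
# THE SAVED ORDER BOUND AT ANY ODD INERT `p ∈ S`, IMAGE-KEYED, with the identity-component label (B6) asked ONLY AT THE CARRIER PRIMES outside `S`
# (TD frame; the Milne I.3.8 input is a KERNEL THEOREM) — the non-print half of `Theorems.ShimuraInertSavedDisplayAtD W p q₁` per Heegner field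
# (cell `bsd-stepL`, seat `bsd-stepL-corner3-p2` g10 = WIDTH-LEVER lane B; `--supports stmt-BirchSwinnertonDyer-21420 --as helper`; serves crux 19065's
# slot-6 `stub_shimuraLabelsB6_57` re-cut to (B6)-at-`{q₁}` (corner-p1 g16, STATUS 08:49Z) at `p ∈ {5, 7}` and 19109 ∕ 21420 at `p = 3`)

WHAT. `ShimuraKolyvaginOfImage.savedOrderBound_of_labels_ofImage_of_carrierLabels`: lane B g9's `savedOrderBound_of_labels_ofImage` (p611996) VERBATIM with the
hypothesis `hB6 : LabelB6 ι W N (N.primeFactors.filter (· ∉ S)) ys` REPLACED by the per-carrier singleton labels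
`hB6T : ∀ q [Fact q.Prime], q ∣ N → q ∉ S → p ∣ c_q(E/ℚ_q) → LabelB6 ι W N {q} ys`: if `y` is non-torsion then for every prime `q₁ ∉ S`
`ord_p #Ш(E/K)[p^∞] + 2·ord_p c_{q₁}(E) ≤ 2·ord_p [E(K) : ℤy]`, the `hDivLab` of the image-keyed ORDER END being lane B g10's
`Koly.shimuraDivClause_of_poitouTate_ofImage_of_carrierLabels` (port targets on the TD frame: (B6) at the carriers for the receptacle and the stringent
condition, Milne *ADT* I Prop. 3.8 — KERNEL, `MilneTamagawa.Milne2006_localTamagawaNumber_smul_unramifiedClass_eq_zero_holds` — at the Tamagawa-free places).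
On an up-to-one frame the only carrier outside `S` is the exempted `q₁`, so the consumer's label obligation is `LabelB6 ι W N {q₁} ys` alone.

HONEST FRAMING: ONE conditional theorem; no definition, no named fact, no `sorry`; its non-print inputs are (B6) AT THE CARRIERS and the image inputs;
nothing booked; no stub ∕ item closes; no census label moves (T7); BSD is not proved by any of this.
References (locators only): [cite: Jetchev2008, Thm. 1.1, (1), Cor. 1.5 (p. 812)] [cite: McCallumLMS1991, §1 Theorem, Cor. 5.6] [cite: Kim2022HigherGZ,
Rem. 7.9] [cite: GrossLMS1991, §3 (3.2), §6] [cite: MilneADT2006, Ch. I Prop. 3.8, Thm. 4.10(b), Thm. 6.13(a)]. Axioms: `propext`, `Classical.choice`, `Quot.sound`.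
-/

set_option autoImplicit false
set_option linter.dupNamespace false

noncomputable section

open scoped Classical AddSubgroup

open WeierstrassCurve NumberField IsDedekindDomain Field Function Finset Literature.NumberTheory.EllipticCurves
  Literature.NumberTheory.GaloisRepresentations Literature.NumberTheory.GaloisCohomology
  Literature.NumberTheory.EllipticCurves.KolyvaginCocycle Literature.NumberTheory.EllipticCurves.RingClassField
  Literature.NumberTheory.EllipticCurves.ModularForms Literature.NumberTheory.EllipticCurves.Rank1Residual
  Literature.NumberTheory.EllipticCurves.KolyvaginEuler Literature.NumberTheory.EllipticCurves.KolyvaginDescent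
  Summit.BirchSwinnertonDyer.Rank1Residual Summit.BirchSwinnertonDyer.Rank1Residual.X11b
  Literature.NumberTheory.EllipticCurves.ShimuraCMFamily

namespace Summit.BirchSwinnertonDyer.BirchSwinnertonDyer.Theorems.ShimuraKolyvaginOfImage

/-- **The SAVED order bound `ord_p #Ш(E/K)[p^∞] + 2·ord_p c_{q₁}(E) ≤ 2·ord_p [E(K):ℤy]` at any odd inert `p ∈ S`, `q₁ ∉ S`, from the labels with
(B6) ONLY AT THE CARRIER PRIMES outside `S`, the four mod-`p` image inputs, Poitou–Tate and `casselsTate_levelInputs K`** — p611996 re-keyed: the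
`hDivLab` of the `p`-generic D7 is `Koly.shimuraDivClause_of_poitouTate_ofImage_of_carrierLabels` (Milne I.3.8 input KERNEL). CONDITIONAL; nothing booked.
[cite: Jetchev2008, Thm. 1.1 and Cor. 1.5] [cite: McCallumLMS1991, §1 Theorem (Kolyvagin), Cor. 5.6] [cite: MilneADT2006, Ch. I Prop. 3.8] -/
theorem savedOrderBound_of_labels_ofImage_of_carrierLabels
    (hPT : ∀ (K : Type) [Field K] [NumberField K], poitouTate_selmerStructure_duality_conj K)
    (W : WeierstrassCurve ℚ) [W.IsElliptic] [W.IsGloballyMinimal] (N : ℕ) [NeZero N]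
    (K : Type) [Field K] [NumberField K] (S : Finset ℕ) (Dt : ModularParametrizationData W N)
    (hN : W.conductorNorm ℤ = N) {p : ℕ} [Fact p.Prime] (hp2 : p ≠ 2) (hirr : W.HasIrreducibleModPGaloisRep p)
    (hK : IsImaginaryQuadratic K) (hD : NumberField.discr K < -4)
    (hin : ∀ ℓ ∈ S, ℓ.Prime ∧ ℓ ∣ N ∧ ¬ ℓ ^ 2 ∣ N ∧
      ((Ideal.span {(ℓ : ℤ)}).primesOver (𝓞 K)).ncard = 1 ∧ ¬ (ℓ : ℤ) ∣ NumberField.discr K)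
    (hsp : ∀ ℓ : ℕ, ℓ.Prime → ℓ ∣ N → ℓ ∉ S → ((Ideal.span {(ℓ : ℤ)}).primesOver (𝓞 K)).ncard = 2)
    (hpS : p ∈ S) (ι : K →+* ℂ) (y : (W.baseChange K).toAffine.Point)
    (ys : (m : ℕ) → (W.baseChange (ringClassField K ι m)).toAffine.Point) (ε : ℤ)
    (hL : ShimuraWalk.LabelsAt W N K ι y ys ε)
    (hB6T : ∀ (q : ℕ) [Fact q.Prime], q ∣ N → q ∉ S → p ∣ (W.baseChange ℚ_[q]).localTamagawaNumber ℤ_[q] →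
      LabelB6 ι W N {q} ys)
    (hIz : ∃ z : Field.absoluteGaloisGroup K, ∀ t : geomTorsion (W.baseChange K) p, z • t = -t)
    (hIs : (W.baseChange K).HasIrreducibleModPGaloisRep p)
    (hIc : ∀ f : geomTorsion (W.baseChange K) p →+ geomTorsion (W.baseChange K) p,
      (∀ (g : Field.absoluteGaloisGroup K) (t : geomTorsion (W.baseChange K) p), f (g • t) = g • f t) →
        ∃ k : ℤ, ∀ t, f t = k • t)
    (hIt : AddSubgroup.torsionBy (W.baseChange K).toAffine.Point (p : ℤ) = ⊥)
    (hCT : Literature.NumberTheory.EllipticCurves.casselsTate_levelInputs K)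
    (hguard : ¬ IsOfFinAddOrder y → 0 < (AddSubgroup.zmultiples y).index) (hnt : ¬ IsOfFinAddOrder y)
    (q₁ : ℕ) [Fact q₁.Prime] (hq₁S : q₁ ∉ S) :
    padicValNat p (Nat.card (AddCommGroup.primaryComponent (W.baseChange K).sha p)) +
        2 * padicValNat p ((W.baseChange ℚ_[q₁]).localTamagawaNumber ℤ_[q₁]) ≤
      2 * padicValNat p (AddSubgroup.zmultiples y).index := by
  obtain ⟨hε, hB2, hB3, hB3K, hB4, hB5⟩ := id hL
  have hDIV := Summit.BirchSwinnertonDyer.Rank1Residual.X11b.Three.Koly.shimuraDivClause_of_poitouTate_ofImage_of_carrierLabels hPT W N K S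
    Dt hN hp2 hirr hK hD hin hsp hpS ι y ys ε hL hB6T hIz hIs hIc hIt
  exact padicValNat_card_sha_primary_add_le_of_shimuraLabels_ofImage_of_casselsTate_of_divLab hCT hN hp2 hirr hK ι Dt hin hsp hpS
    hIz hIs hIc hIt ys hε hguard hB2 hB3 hB3K hB4 hB5 _ (hDIV q₁ _ hq₁S le_rfl) hnt

end Summit.BirchSwinnertonDyer.BirchSwinnertonDyer.Theorems.ShimuraKolyvaginOfImage

end
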